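import Summits.Ventures.YMGap.FlowData.SU2WeightCharacterSeries
import HarnessLib

/-!
# Venture YMGap, track Y3 FLOW-DATA — the sup-norm CHARACTER TAIL of the `SU(2)` Wilson plaquette weight
# (lineage A «sntm», ENGINE.md §3 (ii): the constant `τ` of the bracketing builds; theorems only)

HONEST FRAMING: venture file of the cell `pub-ymgap` (QuantumFields programme), track Y3, lineage A (seat
flow-eng-1).  Pure `SU(2)` calculus: NO lattice, NO transfer matrix, NO number of record, nothing about limits or a
mass gap.  It types the ONE link of the lineage-A certificate chain that `RitzDeflationCertificate` /
`RelativeBracketCertificate` take as a hypothesis (ENGINE.md §8: «the sup-norm plaquette tail τ … derivation from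
the Bessel tails NOT formalised»): the plaquette weight `w(X) = e^{b a₀(X)}` (`a₀ = ½ Re tr`, `b = β`) and its
character truncation `w_N(X) = Σ_{n<N} c_n(b) χ_n(X)`, `c_n(b) = I_n(b) − I_{n+2}(b) ≥ 0`, `χ_n = U_n(a₀)`, satisfy
AT EVERY GROUP ELEMENT

* `abs_weight_sub_truncWeight_le` — `|w(X) − w_N(X)| ≤ τ_N(b) := Σ_{n ≥ N} (n+1) c_n(b)` (from the tree's
  character series `hasSum_besselISub_mul_su2Character` and `|χ_n| ≤ n+1`);
* `succ_mul_charCoeff_eq` — the terms in the engine's form `(n+1) c_n = 2(n+1)² I_{n+1}/b`;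
* `tailSum_le_besselBound` — the COMPUTABLE majorant
  `τ_N(b) ≤ (N+1) I_N(b) + (N+2) I_{N+1}(b) + 2 I_{N+2}(b)/(1 − b/(2(N+3)))` for `0 ≤ b < 2(N+3)`
  (telescoping `Σ (n+1)(I_n − I_{n+2})` and the ratio bound `I_{n+1} ≤ b/(2(n+1))·I_n` of the tree), and
  `tailSum_le_of_besselI_le` — the same with the three Bessel values replaced by any upper bounds (the engine's
  certified enclosures `cert.I_iv` enter here, exactly as the IEEE facts enter `RitzDeflationCertificate`);
* `sum_range_besselTerm_le` / `besselI_le_sum_range_add` — two-sided RATIONAL enclosures of every `I_n(x)`, `x ≥ 0`, by a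
  partial power sum and a geometric tail (`q = (x/2)²/((K+1)(K+n+1)) < 1`), so that for rational `b` the constant `τ` (and `c₀`,
  `charCoeff_zero_eq`) is bounded by rationals inside Lean — no Bessel value needs to be taken as a hypothesis
  (assembled: `tailSum_div_charCoeff_le`);
* `weight_mem_Icc` (`e^{−b} ≤ w ≤ e^{b}`), `weight_mem_Icc_truncWeight`, `abs_truncWeight_le` (`|w_N| ≤ w_N + 2τ`, TAIL-2's `w⁺`);
* `prod_sub_le_prod_weight` / `prod_weight_le_prod_add` — the POINTWISE BRACKET over a finite family of plaquettes:
  `|w_p − w'_p| ≤ τ`, `0 ≤ w'_p − τ` ⇒ `Π (w'_p − τ) ≤ Π w_p ≤ Π (w'_p + τ)` (ENGINE.md §3 (ii); the operator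
  sandwich `G⁻ ⪯ G_S ⪯ G⁺` is then monotonicity of compression by non-negative multiplication operators, typed as
  the hypotheses `hrel_lo` / `hrel_hi` of `RelativeBracket.bracket1_block_enclosure`).

In the engine's normalisation `w/c₀`, `c₀ = c_0(b) = 2I_1(b)/b`, the constant is `τ = τ_{J_c+1}(b)/c₀`
(`2J ≤ J_c` ⇔ `n ≤ J_c`), see `abs_normWeight_sub_le`.  Companion files: `PlaquetteCharacterTailInstances` (the constants of
the table as `norm_num` instances) and `GalerkinWeightMonotone` (the Loewner sandwich from the pointwise bracket).

References: I. Montvay, G. Münster, *Quantum Fields on a Lattice* (1994) §3.2.6 [cite: MontvayMunster1994, §3.2.6];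
DLMF §10.29, §10.37; Abramowitz–Stegun 9.6.10 [cite: AbramowitzStegun1964, 9.6.10].
-/

noncomputable section

open scoped BigOperators Topology
open Filter Finset Polynomial.Chebyshev
open Literature.Analysis.FunctionSpaces
open Summit.Ventures.LatticeQCDFlow.Exactness Summit.Ventures.LatticeQCDFlow.Scoring

namespace Summit.Ventures.YMGap.FlowData.PlaquetteCharacterTail

/-! ### Objects -/

/-- The character coefficient `c_n(b) = I_n(b) − I_{n+2}(b)` of the Wilson weight `e^{b a₀}`.
[cite: MontvayMunster1994, §3.2.6] -/
def charCoeff (b : ℝ) (n : ℕ) : ℝ := besselI n b - besselI (n + 2) b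

/-- The character truncation `w_N(b, X) = Σ_{n<N} c_n(b) χ_n(X)` of the plaquette weight (the engine keeps
`n = 2J ≤ J_c`, i.e. `N = J_c + 1`). [cite: MontvayMunster1994, §3.2.6] -/
def truncWeight (b : ℝ) (N : ℕ) (X : Matrix.specialUnitaryGroup (Fin 2) ℂ) : ℝ :=
  ∑ n ∈ range N, charCoeff b n * (U ℝ n).eval (su2a0 X)

/-- The tail majorant `τ_N(b) = Σ_{n ≥ N} (n+1) c_n(b)` (ENGINE.md §3 (ii): `τ ≥ sup |w − w^{(J_c)}|`, in units
of `c₀`). [cite: MontvayMunster1994, §3.2.6] -/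
def tailSum (b : ℝ) (N : ℕ) : ℝ := ∑' n : ℕ, (((n + N : ℕ) : ℝ) + 1) * charCoeff b (n + N)

/-- `c_n(b) ≥ 0` for `b ≥ 0`. [folklore] -/
theorem charCoeff_nonneg {b : ℝ} (hb : 0 ≤ b) (n : ℕ) : 0 ≤ charCoeff b n :=
  besselISub_nonneg hb n

/-- The shifted majorant series `(n+N+1) c_{n+N}(b)` is summable (`b ≥ 0`). [folklore] -/
theorem summable_tail {b : ℝ} (hb : 0 ≤ b) (N : ℕ) :
    Summable fun n : ℕ => (((n + N : ℕ) : ℝ) + 1) * charCoeff b (n + N) := by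
  have h := summable_succ_mul_besselISub hb
  exact (summable_nat_add_iff N).2 h

/-- `τ_N(b) ≥ 0` for `b ≥ 0`. [folklore] -/
theorem tailSum_nonneg {b : ℝ} (hb : 0 ≤ b) (N : ℕ) : 0 ≤ tailSum b N :=
  tsum_nonneg fun n => mul_nonneg (by positivity) (charCoeff_nonneg hb _)

/-- The engine's form of the majorant's terms: `(n+1) c_n(b) = 2 (n+1)² I_{n+1}(b)/b` (`b ≠ 0`), i.e. in units of
`c₀ = 2I_1(b)/b` the term is `(n+1)² I_{n+1}(b)/I_1(b)` (`kit_build.exact_constants`). [cite: DLMF, 10.29.1] -/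
theorem succ_mul_charCoeff_eq {b : ℝ} (hb : b ≠ 0) (n : ℕ) :
    ((n : ℝ) + 1) * charCoeff b n = 2 * ((n : ℝ) + 1) ^ 2 * besselI (n + 1) b / b := by
  have h := besselISub_div_succ hb n
  have hn : ((n : ℝ) + 1) ≠ 0 := by positivity
  rw [div_eq_iff hn] at h
  rw [charCoeff, h]; ring

/-! ### The sup-norm tail bound at every group element -/

/-- **`|w(X) − w_N(X)| ≤ τ_N(b)`** for every `X ∈ SU(2)` and `b ≥ 0`: the character truncation error of the
Wilson plaquette weight is bounded, uniformly on the group, by the tail of `Σ (n+1) c_n(b)`.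
[cite: MontvayMunster1994, §3.2.6] -/
theorem abs_weight_sub_truncWeight_le {b : ℝ} (hb : 0 ≤ b) (N : ℕ) (X : Matrix.specialUnitaryGroup (Fin 2) ℂ) :
    |Real.exp (b * su2a0 X) - truncWeight b N X| ≤ tailSum b N := by
  have hs := hasSum_besselISub_mul_su2Character hb X
  -- the remainder after `N` terms is the shifted series
  have hshift : HasSum (fun n : ℕ => charCoeff b (n + N) * (U ℝ (n + N)).eval (su2a0 X))
      (Real.exp (b * su2a0 X) - truncWeight b N X) := by
    have := (hasSum_nat_add_iff' N).2 hs
    simpa [truncWeight, charCoeff] using this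
  rw [← hshift.tsum_eq, ← Real.norm_eq_abs]
  refine (norm_tsum_le_tsum_norm hshift.summable.norm).trans ?_
  refine hshift.summable.norm.tsum_le_tsum (fun n => ?_) (summable_tail hb N)
  rw [Real.norm_eq_abs, abs_mul, abs_of_nonneg (charCoeff_nonneg hb _), mul_comm]
  exact mul_le_mul_of_nonneg_right (by exact_mod_cast abs_su2Character_le (n + N) X) (charCoeff_nonneg hb _)

/-! ### The computable majorant of `τ_N(b)` -/

/-- Iterated ratio bound: `I_{M+k}(b) ≤ (b/(2(M+1)))^k · I_M(b)` for `b ≥ 0`.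
[cite: AbramowitzStegun1964, 9.6.10] -/
theorem besselI_add_le_pow_mul {b : ℝ} (hb : 0 ≤ b) (M k : ℕ) :
    besselI (M + k) b ≤ (b / (2 * ((M : ℝ) + 1))) ^ k * besselI M b := by
  induction k with
  | zero => simp
  | succ k ih =>
    have h1 := besselI_succ_le_div_mul (M + k) hb
    have hr : b / (2 * (((M + k : ℕ) : ℝ) + 1)) ≤ b / (2 * ((M : ℝ) + 1)) := by
      apply div_le_div_of_nonneg_left hb (by positivity)
      push_cast; nlinarith
    have hI : 0 ≤ besselI (M + k) b := besselI_nonneg _ hb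
    calc besselI (M + (k + 1)) b = besselI (M + k + 1) b := by rw [Nat.add_assoc]
      _ ≤ b / (2 * (((M + k : ℕ) : ℝ) + 1)) * besselI (M + k) b := h1
      _ ≤ b / (2 * ((M : ℝ) + 1)) * besselI (M + k) b := mul_le_mul_of_nonneg_right hr hI
      _ ≤ b / (2 * ((M : ℝ) + 1)) * ((b / (2 * ((M : ℝ) + 1))) ^ k * besselI M b) :=
          mul_le_mul_of_nonneg_left ih (by positivity)
      _ = (b / (2 * ((M : ℝ) + 1))) ^ (k + 1) * besselI M b := by ring

/-- Finite telescoping of the majorant: for every `K`,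
`Σ_{n<K} (n+N+1)(I_{n+N} − I_{n+N+2}) ≤ (N+1) I_N + (N+2) I_{N+1} + 2 Σ_{n<K} I_{n+N+2}` (`b ≥ 0`; the two dropped
boundary terms are `≤ 0`). [folklore] -/
theorem sum_range_tail_le {b : ℝ} (hb : 0 ≤ b) (N K : ℕ) :
    ∑ n ∈ range K, (((n + N : ℕ) : ℝ) + 1) * charCoeff b (n + N) ≤
      ((N : ℝ) + 1) * besselI N b + ((N : ℝ) + 2) * besselI (N + 1) b +
        2 * ∑ n ∈ range K, besselI (n + N + 2) b := by
  -- a_n := (n+N+1) I_{n+N};  term_n = a_n − a_{n+2} + 2 I_{n+N+2}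
  set a : ℕ → ℝ := fun n => (((n + N : ℕ) : ℝ) + 1) * besselI (n + N) b with ha
  have hterm : ∀ n, (((n + N : ℕ) : ℝ) + 1) * charCoeff b (n + N) = (a n - a (n + 2)) + 2 * besselI (n + N + 2) b := by
    intro n
    simp only [ha, charCoeff, show n + 2 + N = n + N + 2 by omega]
    push_cast; ring
  simp_rw [hterm]
  rw [sum_add_distrib, ← mul_sum]
  -- telescoping: Σ_{n<K} (a n − a (n+2)) = a 0 + a 1 − a K − a (K+1)
  have htel : ∀ K, ∑ n ∈ range K, (a n - a (n + 2)) = a 0 + a 1 - a K - a (K + 1) := by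
    intro K
    induction K with
    | zero => simp
    | succ K ih => rw [sum_range_succ, ih]; ring
  rw [htel]
  have haK : 0 ≤ a K := mul_nonneg (by positivity) (besselI_nonneg _ hb)
  have haK1 : 0 ≤ a (K + 1) := mul_nonneg (by positivity) (besselI_nonneg _ hb)
  have ha0 : a 0 = ((N : ℝ) + 1) * besselI N b := by simp [ha]
  have ha1 : a 1 = ((N : ℝ) + 2) * besselI (N + 1) b := by
    simp only [ha, show 1 + N = N + 1 by omega]; push_cast; ring
  rw [ha0, ha1]
  linarith

/-- The geometric bound on the Bessel tail: `Σ_{n<K} I_{n+N+2}(b) ≤ I_{N+2}(b)/(1 − r)`, `r = b/(2(N+3)) < 1`.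
[cite: AbramowitzStegun1964, 9.6.10] -/
theorem sum_range_besselI_le {b : ℝ} (hb : 0 ≤ b) (N K : ℕ) (hr : b < 2 * ((N : ℝ) + 3)) :
    ∑ n ∈ range K, besselI (n + N + 2) b ≤ besselI (N + 2) b / (1 - b / (2 * ((N : ℝ) + 3))) := by
  set r : ℝ := b / (2 * ((N : ℝ) + 3)) with hrdef
  have hr0 : 0 ≤ r := by positivity
  have hr1 : r < 1 := by rw [hrdef, div_lt_one (by positivity)]; linarith
  have hI : 0 ≤ besselI (N + 2) b := besselI_nonneg _ hb
  calc ∑ n ∈ range K, besselI (n + N + 2) b ≤ ∑ n ∈ range K, r ^ n * besselI (N + 2) b := by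
        refine sum_le_sum fun n _ => ?_
        have h := besselI_add_le_pow_mul hb (N + 2) n
        rw [show N + 2 + n = n + N + 2 by omega] at h
        refine h.trans (le_of_eq ?_)
        rw [hrdef]; push_cast; ring
    _ = (∑ n ∈ range K, r ^ n) * besselI (N + 2) b := by rw [sum_mul]
    _ ≤ (1 - r)⁻¹ * besselI (N + 2) b := by
        refine mul_le_mul_of_nonneg_right ?_ hI
        have hg := summable_geometric_of_lt_one hr0 hr1
        calc ∑ n ∈ range K, r ^ n ≤ ∑' n : ℕ, r ^ n := hg.sum_le_tsum (range K) fun n _ => pow_nonneg hr0 n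
          _ = (1 - r)⁻¹ := tsum_geometric_of_lt_one hr0 hr1
    _ = besselI (N + 2) b / (1 - r) := by rw [div_eq_inv_mul]

/-- **The computable majorant**: `τ_N(b) ≤ (N+1) I_N(b) + (N+2) I_{N+1}(b) + 2 I_{N+2}(b)/(1 − b/(2(N+3)))`
for `0 ≤ b < 2(N+3)`. [cite: AbramowitzStegun1964, 9.6.10] -/
theorem tailSum_le_besselBound {b : ℝ} (hb : 0 ≤ b) (N : ℕ) (hr : b < 2 * ((N : ℝ) + 3)) :
    tailSum b N ≤ ((N : ℝ) + 1) * besselI N b + ((N : ℝ) + 2) * besselI (N + 1) b +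
      2 * (besselI (N + 2) b / (1 - b / (2 * ((N : ℝ) + 3)))) := by
  refine (summable_tail hb N).tsum_le_of_sum_range_le fun K => ?_
  have h1 := sum_range_tail_le hb N K
  have h2 := sum_range_besselI_le hb N K hr
  linarith

/-- **The majorant from certified Bessel enclosures**: any upper bounds `iN ≥ I_N(b)`, `iN1 ≥ I_{N+1}(b)`,
`iN2 ≥ I_{N+2}(b)` (the engine's interval values `cert.I_iv`) give
`τ_N(b) ≤ (N+1) iN + (N+2) iN1 + 2 iN2/(1 − b/(2(N+3)))`. [cite: AbramowitzStegun1964, 9.6.10] -/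
theorem tailSum_le_of_besselI_le {b iN iN1 iN2 : ℝ} (hb : 0 ≤ b) (N : ℕ) (hr : b < 2 * ((N : ℝ) + 3))
    (hN : besselI N b ≤ iN) (hN1 : besselI (N + 1) b ≤ iN1) (hN2 : besselI (N + 2) b ≤ iN2) :
    tailSum b N ≤ ((N : ℝ) + 1) * iN + ((N : ℝ) + 2) * iN1 + 2 * (iN2 / (1 - b / (2 * ((N : ℝ) + 3)))) := by
  have h := tailSum_le_besselBound hb N hr
  have hden : 0 < 1 - b / (2 * ((N : ℝ) + 3)) := by
    rw [sub_pos, div_lt_one (by positivity)]; linarith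
  have h3 : besselI (N + 2) b / (1 - b / (2 * ((N : ℝ) + 3))) ≤ iN2 / (1 - b / (2 * ((N : ℝ) + 3))) :=
    div_le_div_of_nonneg_right hN2 hden.le
  have h4 : ((N : ℝ) + 1) * besselI N b ≤ ((N : ℝ) + 1) * iN := mul_le_mul_of_nonneg_left hN (by positivity)
  have h5 : ((N : ℝ) + 2) * besselI (N + 1) b ≤ ((N : ℝ) + 2) * iN1 := mul_le_mul_of_nonneg_left hN1 (by positivity)
  linarith

/-- The assembled sup-norm certificate: `|w(X) − w_N(X)| ≤ (N+1) iN + (N+2) iN1 + 2 iN2/(1 − b/(2(N+3)))` at every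
`X ∈ SU(2)`, for any certified upper Bessel values. [cite: MontvayMunster1994, §3.2.6] -/
theorem abs_weight_sub_truncWeight_le_of_besselI_le {b iN iN1 iN2 : ℝ} (hb : 0 ≤ b) (N : ℕ)
    (hr : b < 2 * ((N : ℝ) + 3)) (hN : besselI N b ≤ iN) (hN1 : besselI (N + 1) b ≤ iN1)
    (hN2 : besselI (N + 2) b ≤ iN2) (X : Matrix.specialUnitaryGroup (Fin 2) ℂ) :
    |Real.exp (b * su2a0 X) - truncWeight b N X| ≤
      ((N : ℝ) + 1) * iN + ((N : ℝ) + 2) * iN1 + 2 * (iN2 / (1 - b / (2 * ((N : ℝ) + 3)))) :=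
  (abs_weight_sub_truncWeight_le hb N X).trans (tailSum_le_of_besselI_le hb N hr hN hN1 hN2)

/-! ### Range of the weight and of its truncation (the constants `w_min·c₀ = e^{−b}`, `R·c₀ = e^{b}`, `w⁺`) -/

/-- `e^{−b} ≤ w(X) ≤ e^{b}` on `SU(2)` (`b ≥ 0`): the extreme values of the plaquette weight (ENGINE.md §3:
`w_min = e^{−β}/c₀`, `R = e^{β}/c₀`). [folklore] -/
theorem weight_mem_Icc {b : ℝ} (hb : 0 ≤ b) (X : Matrix.specialUnitaryGroup (Fin 2) ℂ) :
    Real.exp (b * su2a0 X) ∈ Set.Icc (Real.exp (-b)) (Real.exp b) := by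
  have h := abs_le.1 (abs_su2a0_le_one X)
  constructor <;> apply Real.exp_le_exp.2 <;> nlinarith [h.1, h.2]

/-- `|w_N(X)| ≤ w_N(X) + 2τ` whenever `τ ≥ τ_N(b)` (`b ≥ 0`): the bound `w⁺` on the main build's weight used by
TAIL-2 (ENGINE.md §6.1; from `w ≥ 0` and `|w − w_N| ≤ τ`). [folklore] -/
theorem abs_truncWeight_le {b τ : ℝ} (hb : 0 ≤ b) (N : ℕ) (X : Matrix.specialUnitaryGroup (Fin 2) ℂ)
    (hτ : tailSum b N ≤ τ) : |truncWeight b N X| ≤ truncWeight b N X + 2 * τ := by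
  have h := abs_sub_le_iff.1 ((abs_weight_sub_truncWeight_le hb N X).trans hτ)
  have hw : 0 ≤ Real.exp (b * su2a0 X) := (Real.exp_pos _).le
  rw [abs_le]; constructor <;> linarith [h.1, h.2]

/-- `w_N(X) − τ ≤ w(X)` and `w(X) ≤ w_N(X) + τ` for `τ ≥ τ_N(b)`: the one-plaquette bracket. [folklore] -/
theorem weight_mem_Icc_truncWeight {b τ : ℝ} (hb : 0 ≤ b) (N : ℕ) (X : Matrix.specialUnitaryGroup (Fin 2) ℂ)
    (hτ : tailSum b N ≤ τ) :
    Real.exp (b * su2a0 X) ∈ Set.Icc (truncWeight b N X - τ) (truncWeight b N X + τ) := by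
  have h := abs_sub_le_iff.1 ((abs_weight_sub_truncWeight_le hb N X).trans hτ)
  constructor <;> linarith [h.1, h.2]

/-! ### Rational enclosures of the Bessel VALUES (so that `τ` is bounded by rationals inside Lean for rational `b`) -/

/-- The `k`-th term of the power series of `I_n(x)`: `t_k = (x/2)^{2k+n}/(k!(k+n)!)`. [cite: DLMF, 10.25.2] -/
def besselTerm (n : ℕ) (x : ℝ) (k : ℕ) : ℝ := (x / 2) ^ (2 * k + n) / ((Nat.factorial k : ℝ) * (Nat.factorial (k + n) : ℝ))

/-- The power-series terms of `I_n(x)` are `≥ 0` for `x ≥ 0`. [cite: DLMF, 10.25.2] -/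
theorem besselTerm_nonneg (n : ℕ) {x : ℝ} (hx : 0 ≤ x) (k : ℕ) : 0 ≤ besselTerm n x k := by
  unfold besselTerm; positivity

/-- `I_n(x) = Σ_k t_k` (the tree's `hasSum_besselI`, restated for `besselTerm`). [cite: DLMF, 10.25.2] -/
theorem hasSum_besselTerm (n : ℕ) (x : ℝ) : HasSum (fun k => besselTerm n x k) (besselI n x) := by
  simp only [besselTerm]
  exact hasSum_besselI n x

/-- The term ratio: `t_{k+1} = t_k · (x/2)²/((k+1)(k+n+1))`. [cite: DLMF, 10.25.2] -/
theorem besselTerm_succ (n : ℕ) (x : ℝ) (k : ℕ) :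
    besselTerm n x (k + 1) = besselTerm n x k * ((x / 2) ^ 2 / (((k : ℝ) + 1) * ((k : ℝ) + n + 1))) := by
  unfold besselTerm
  rw [show 2 * (k + 1) + n = (2 * k + n) + 2 by ring, show k + 1 + n = (k + n) + 1 by ring, pow_add,
    Nat.factorial_succ, Nat.factorial_succ]
  push_cast
  have h1 : ((k : ℝ) + 1) ≠ 0 := by positivity
  have h2 : ((k : ℝ) + n + 1) ≠ 0 := by positivity
  have h3 : ((Nat.factorial k : ℕ) : ℝ) ≠ 0 := by positivity
  have h4 : ((Nat.factorial (k + n) : ℕ) : ℝ) ≠ 0 := by positivity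
  field_simp
  try ring

/-- **Lower enclosure**: every partial sum of the (non-negative) power series is below `I_n(x)` (`x ≥ 0`).
[cite: DLMF, 10.25.2] -/
theorem sum_range_besselTerm_le (n K : ℕ) {x : ℝ} (hx : 0 ≤ x) :
    ∑ k ∈ range K, besselTerm n x k ≤ besselI n x :=
  (hasSum_besselTerm n x).summable.sum_le_tsum (range K) (fun k _ => besselTerm_nonneg n hx k) |>.trans
    (le_of_eq (hasSum_besselTerm n x).tsum_eq)

/-- **Upper enclosure**: `I_n(x) ≤ Σ_{k<K} t_k + t_K/(1 − q)` with `q = (x/2)²/((K+1)(K+n+1)) < 1` (`x ≥ 0`; geometric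
majorant of the tail, the term ratio being `≤ q` from `K` on). [cite: DLMF, 10.25.2] -/
theorem besselI_le_sum_range_add (n K : ℕ) {x : ℝ} (hx : 0 ≤ x)
    (hq : (x / 2) ^ 2 < ((K : ℝ) + 1) * ((K : ℝ) + n + 1)) :
    besselI n x ≤ ∑ k ∈ range K, besselTerm n x k +
      besselTerm n x K / (1 - (x / 2) ^ 2 / (((K : ℝ) + 1) * ((K : ℝ) + n + 1))) := by
  set q : ℝ := (x / 2) ^ 2 / (((K : ℝ) + 1) * ((K : ℝ) + n + 1)) with hqdef
  have hq0 : 0 ≤ q := by positivity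
  have hq1 : q < 1 := by rw [hqdef, div_lt_one (by positivity)]; exact hq
  have hs := (hasSum_besselTerm n x).summable
  rw [← (hasSum_besselTerm n x).tsum_eq, ← hs.sum_add_tsum_nat_add K]
  gcongr
  have tail : ∀ i : ℕ, besselTerm n x (i + K) ≤ besselTerm n x K * q ^ i := by
    intro i
    induction i with
    | zero => simp
    | succ i ih =>
      rw [show i + 1 + K = (i + K) + 1 by ring, besselTerm_succ, show q ^ (i + 1) = q ^ i * q from pow_succ q i,
        ← mul_assoc]
      refine mul_le_mul ih ?_ (by positivity) (mul_nonneg (besselTerm_nonneg n hx K) (pow_nonneg hq0 i))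
      rw [hqdef]
      have hK : (K : ℝ) + 1 ≤ ((i + K : ℕ) : ℝ) + 1 := by push_cast; linarith
      have hK' : (K : ℝ) + n + 1 ≤ ((i + K : ℕ) : ℝ) + n + 1 := by push_cast; linarith
      have hp : (0 : ℝ) < ((K : ℝ) + 1) * ((K : ℝ) + n + 1) := by positivity
      exact div_le_div_of_nonneg_left (by positivity) hp (mul_le_mul hK hK' (by positivity) (by positivity))
  have hsum_tail : Summable fun i => besselTerm n x (i + K) := (summable_nat_add_iff K).mpr hs
  calc ∑' i, besselTerm n x (i + K) ≤ ∑' i, besselTerm n x K * q ^ i :=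
        hsum_tail.tsum_le_tsum tail ((summable_geometric_of_lt_one hq0 hq1).mul_left _)
    _ = besselTerm n x K / (1 - q) := by
        rw [tsum_mul_left, tsum_geometric_of_lt_one hq0 hq1, div_eq_mul_inv]

/-- `c₀(b) = 2 I_1(b)/b` (`b ≠ 0`), so a partial sum of `I_1` bounds `c₀` from below. [cite: DLMF, 10.29.1] -/
theorem charCoeff_zero_eq {b : ℝ} (hb : b ≠ 0) : charCoeff b 0 = 2 * besselI 1 b / b := by
  have h := besselISub_div_succ hb 0
  simp only [Nat.cast_zero, zero_add, div_one] at h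
  exact h

/-! ### The engine's normalisation `w/c₀` -/

/-- `c₀(b) = c_0(b) = I_0(b) − I_2(b) = 2 I_1(b)/b > 0` for `b > 0`. [cite: DLMF, 10.29.1] -/
theorem charCoeff_zero_pos {b : ℝ} (hb : 0 < b) : 0 < charCoeff b 0 := by
  have h := besselI_succ_lt 1 hb
  have h0 := besselI_succ_le 0 hb.le
  unfold charCoeff
  linarith

/-- **The normalised tail** (ENGINE.md §3 (ii)): with `w̄ = e^{b a₀}/c₀`, `w̄_N = w_N/c₀` and
`τ = τ_N(b)/c₀`, `|w̄(X) − w̄_N(X)| ≤ τ` on all of `SU(2)` (`b > 0`). [cite: MontvayMunster1994, §3.2.6] -/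
theorem abs_normWeight_sub_le {b : ℝ} (hb : 0 < b) (N : ℕ) (X : Matrix.specialUnitaryGroup (Fin 2) ℂ) :
    |Real.exp (b * su2a0 X) / charCoeff b 0 - truncWeight b N X / charCoeff b 0| ≤
      tailSum b N / charCoeff b 0 := by
  have hc := charCoeff_zero_pos hb
  rw [← sub_div, abs_div, abs_of_pos hc]
  exact div_le_div_of_nonneg_right (abs_weight_sub_truncWeight_le hb.le N X) hc.le

/-- **The normalised constant from numeric enclosures**: with ANY upper values `uN ≥ I_N(b)`, `uN1 ≥ I_{N+1}(b)`,
`uN2 ≥ I_{N+2}(b)` and ANY lower value `0 < l1 ≤ I_1(b)` (e.g. the partial power sums of `sum_range_besselTerm_le` /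
`besselI_le_sum_range_add` — rational for rational `b`), the engine's `τ = τ_N(b)/c₀` obeys
`τ ≤ ((N+1) uN + (N+2) uN1 + 2 uN2/(1 − b/(2(N+3)))) / (2 l1/b)` (`0 < b < 2(N+3)`). [cite: MontvayMunster1994, §3.2.6] -/
theorem tailSum_div_charCoeff_le {b uN uN1 uN2 l1 : ℝ} (hb : 0 < b) (N : ℕ) (hr : b < 2 * ((N : ℝ) + 3))
    (hN : besselI N b ≤ uN) (hN1 : besselI (N + 1) b ≤ uN1) (hN2 : besselI (N + 2) b ≤ uN2)
    (hl1 : l1 ≤ besselI 1 b) (hl1pos : 0 < l1) :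
    tailSum b N / charCoeff b 0 ≤
      (((N : ℝ) + 1) * uN + ((N : ℝ) + 2) * uN1 + 2 * (uN2 / (1 - b / (2 * ((N : ℝ) + 3))))) / (2 * l1 / b) := by
  have hnum := tailSum_le_of_besselI_le hb.le N hr hN hN1 hN2
  have hc0 : charCoeff b 0 = 2 * besselI 1 b / b := charCoeff_zero_eq hb.ne'
  have hden : 2 * l1 / b ≤ charCoeff b 0 := by
    rw [hc0]; exact div_le_div_of_nonneg_right (by linarith) hb.le
  have hdenpos : 0 < 2 * l1 / b := by positivity
  have hnum0 : 0 ≤ ((N : ℝ) + 1) * uN + ((N : ℝ) + 2) * uN1 + 2 * (uN2 / (1 - b / (2 * ((N : ℝ) + 3)))) :=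
    (tailSum_nonneg hb.le N).trans hnum
  calc tailSum b N / charCoeff b 0 ≤
        (((N : ℝ) + 1) * uN + ((N : ℝ) + 2) * uN1 + 2 * (uN2 / (1 - b / (2 * ((N : ℝ) + 3))))) / charCoeff b 0 :=
          div_le_div_of_nonneg_right hnum (charCoeff_zero_pos hb).le
    _ ≤ (((N : ℝ) + 1) * uN + ((N : ℝ) + 2) * uN1 + 2 * (uN2 / (1 - b / (2 * ((N : ℝ) + 3))))) / (2 * l1 / b) :=
          div_le_div_of_nonneg_left hnum0 hdenpos hden

/-! ### The pointwise bracket over a finite family of plaquettes -/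

section Bracket

variable {ι : Type*}

/-- Lower bracket: `|w_p − w'_p| ≤ τ` and `0 ≤ w'_p − τ` for every plaquette `p ∈ s` give
`Π_{p∈s} (w'_p − τ) ≤ Π_{p∈s} w_p`. [folklore] -/
theorem prod_sub_le_prod_weight (s : Finset ι) (w w' : ι → ℝ) (τ : ℝ)
    (hclose : ∀ p ∈ s, |w p - w' p| ≤ τ) (hpos : ∀ p ∈ s, 0 ≤ w' p - τ) :
    ∏ p ∈ s, (w' p - τ) ≤ ∏ p ∈ s, w p :=
  prod_le_prod hpos fun p hp => by
    have := (abs_sub_le_iff.1 (hclose p hp)).2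
    linarith

/-- Upper bracket: `|w_p − w'_p| ≤ τ` and `0 ≤ w_p` for every `p ∈ s` give `Π_{p∈s} w_p ≤ Π_{p∈s} (w'_p + τ)`.
[folklore] -/
theorem prod_weight_le_prod_add (s : Finset ι) (w w' : ι → ℝ) (τ : ℝ)
    (hclose : ∀ p ∈ s, |w p - w' p| ≤ τ) (hnonneg : ∀ p ∈ s, 0 ≤ w p) :
    ∏ p ∈ s, w p ≤ ∏ p ∈ s, (w' p + τ) :=
  prod_le_prod hnonneg fun p hp => by
    have := (abs_sub_le_iff.1 (hclose p hp)).1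
    linarith

/-- **The two-sided pointwise bracket of the plaquette product** (ENGINE.md §3 (ii)): for a finite family of
plaquette variables `X_p ∈ SU(2)`, `b > 0`, truncation order `N` and any `τ ≥ τ_N(b)/c₀` with
`w̄_N(X_p) − τ ≥ 0` on the family, `Π_p (w̄_N(X_p) − τ) ≤ Π_p w̄(X_p) ≤ Π_p (w̄_N(X_p) + τ)`.
[cite: MontvayMunster1994, §3.2.6] -/
theorem prod_normWeight_mem_Icc {b τ : ℝ} (hb : 0 < b) (N : ℕ) (s : Finset ι)
    (X : ι → Matrix.specialUnitaryGroup (Fin 2) ℂ) (hτ : tailSum b N / charCoeff b 0 ≤ τ)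
    (hpos : ∀ p ∈ s, 0 ≤ truncWeight b N (X p) / charCoeff b 0 - τ) :
    ∏ p ∈ s, Real.exp (b * su2a0 (X p)) / charCoeff b 0 ∈
      Set.Icc (∏ p ∈ s, (truncWeight b N (X p) / charCoeff b 0 - τ))
        (∏ p ∈ s, (truncWeight b N (X p) / charCoeff b 0 + τ)) := by
  have hclose : ∀ p ∈ s, |Real.exp (b * su2a0 (X p)) / charCoeff b 0 - truncWeight b N (X p) / charCoeff b 0| ≤ τ :=
    fun p _ => (abs_normWeight_sub_le hb N (X p)).trans hτ
  refine ⟨prod_sub_le_prod_weight s _ _ τ hclose hpos, prod_weight_le_prod_add s _ _ τ hclose fun p _ => ?_⟩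
  exact div_nonneg (Real.exp_pos _).le (charCoeff_zero_pos hb).le

end Bracket

end Summit.Ventures.YMGap.FlowData.PlaquetteCharacterTail

end
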